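import Summits.QuantumFields.YangMills.Theorems.BalabanUVNodesN18TermsAtRecord

/-!
# BalabanUVNodes ∕ N18 — THE DATA BOX INSIDE THE WALK ROAD's BALL: route P1's term data (hol) + (226) around an admissible base
# point FROM data on a BALL of the data space centred at the base point, in place or in DISPLACEMENT coordinates — the shape in
# which `TwoRunTorusWalkParam.hol_and_h226_torus_of_termWalkData_param` (any parameter space `B`; here `B := Op × Hist`) delivers them
# (Track A, DAG node N18 = NE5 `T4OutputRate.NE5 EA EB W κ θ C₅` :211; cluster K4 «SpineRates»; file 4 of seat pub-ymgap-dag-n18-c)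

HONEST FRAMING.  Count-neutral kernel bookkeeping (seat pub-ymgap-dag-n18-c g0; `--supports stmt-QuantumFields-19676`): elementary
metric-space plumbing on the product data space `Op × Hist` (sup distance) + composition BY NAME with file 1 of this seat
(`BalabanUVNodesN18HLayerDatum.hH_of_terms226_record`, p450706) and with seat n18-d's term-layer face
(`BalabanUVNodesN18TermsAtRecord`, p453396: `YMDAG.N18.HLayer.n18At_of_terms226_record`).  Every analytic letter is a HYPOTHESIS (the per-term ball data below is what the
walk road T25 `Spine/NE5/TwoRunTorusWalkParam.hol_and_h226_torus_of_termWalkData_param` concludes for ONE term from ONE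
`B13TermWalkData.TermKernels` record with `TermWalkData` over the parameter space `B := Op × Hist` — NODE O's statement (v) read in the
DATA direction, instance 0∕1; the record is NOT constructed here); NE5 NOT IN PRINT ([Balaban1987RG1] Thm 1 p. 259) and NOT PROVED; NOT
a node discharge; one finite four-torus programme at fixed ε; nothing continuum ∕ ℝ⁴ ∕ OS ∕ mass-gap ∕ Clay.  0 `def`, 0 `sorry`.

THE POINT (the located junction between route P1's two-margin box and the walk road's ball).  Route P1 asks for the term data on an OPEN
`V ⊇ M.box j p = closedBall p.1 (rOp j) ×ˢ closedBall p.2 (rHist j)` ([II] (2.16)–(2.18): operator margin, potential budget).  The walk road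
delivers, for a term whose kernels are functions of a parameter `b` of ANY complex normed space `B`, holomorphy of the term and (2.26) on the
ball `‖b‖ < α` (`α` = the admissible configuration size of the record's package, `α < w.R`).  With `B := Op × Hist` and the kernels read
in DISPLACEMENT coordinates `u = z − p` from the base point (reference operators `Γ₀ = G(0,0)`, `C = A(0,0)⁻¹` = the REAL operators AT the
admissible base point, [II] p. 15 *"for the pair (U, 0) the operators are symmetric, and the measure is positive"*), the ball is
`ball p α` in the sup distance of `Op × Hist`, and it contains the box as soon as `rOp j < α` and `rHist j < α` (§1 `box_subset_ball`).
* §1 `box_subset_ball` — `M.box j p ⊆ ball p α` for `M.rOp j < α`, `M.rHist j < α` (`Prod.dist_eq`).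
* §2 `termData_of_ballData_record` — per scale and admissible base point, term data on the ball `ball p (α j)` (in place) ⟹ the
  ∃V-form `hT` of file 1 (`V := ball p (α j)`); `termData_of_displacedBallData_record` — the same from data in DISPLACEMENT coordinates:
  `u ↦ T j Z t (p + u)` complex differentiable on `ball 0 (α j)` with (2.26) there (T25's literal output shape at `B := Op × Hist`),
  translated by `z ↦ z − p`.
* §3 `hH_of_displacedBallData_record` — ∘ file 1 `hH_of_terms226_record`: the H-layer datum `hH` of
  `EnvelopeOnRecord.outputEnvelope_of_activities_record` VERBATIM for the term-sum activities from per-base-point displaced ball data +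
  Lemma 3's printed restrictions; `n18At_of_displacedBallData_record` — ∘ seat n18-d's term-layer face
  `YMDAG.N18.HLayer.n18At_of_terms226_record` (p453396): N18's decl of record `YMDAG.UVSplit.N18At` at the H-layer bundle on the carriers of
  record from PER-MEMBER, per-base-point displaced ball data, the leaves and the located numerals.
So route P1's W2 wall for N18 reads, per term and per admissible base point `p`: «ONE walk record of the term's kernels AS FUNCTIONS OF THE
DATA DISPLACEMENT from `p`, admissible at a configuration size `α` exceeding both margins» + T25's displayed letters (σ-holomorphy,
symmetry ∕ `Re ≻ 0`, potentials with (2.20), (2.22), `SmallTheta`, the p. 17 numerics) — the SAME record type the two-run END (pencil,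
`B = E × ℂ`) and row (D4) (seam, `B = E`) consume.

Sources: T. Bałaban, CMP **116** (1988) [Balaban1988RG2Cluster] (1.5) p. 3, p. 13, p. 15, (2.14)–(2.18) pp. 15–16, (2.26) p. 17,
Lemma 3 (2.38) p. 20; [Balaban1985BackgroundPropagators] Thm 3.10 p. 416; CMP **109** (1987) [Balaban1987RG1] Thm 1 p. 259.
Nothing here is a claim about the Yang–Mills mass gap.
-/

noncomputable section

namespace Summit.QuantumFields.YangMills.BalabanUVNodes.N18HLayerDatumBall

open Set Metric Finset
open Literature.MathematicalPhysics.QuantumFieldTheory.Balaban1983to89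
open Literature.MathematicalPhysics.QuantumFieldTheory.Balaban1983to89.T4OutputRate
open Literature.MathematicalPhysics.QuantumFieldTheory.Balaban1983to89.T4InputCauchyRateData
open Literature.MathematicalPhysics.QuantumFieldTheory.Balaban1983to89.TreeLengthTorus (TPt TDom tsys torusTreeLen)
open Literature.MathematicalPhysics.QuantumFieldTheory.Balaban1983to89.B13Lemma3TorusData (TBond)
open Literature.MathematicalPhysics.QuantumFieldTheory.Balaban1983to89.B13Lemma3TorusTerms (terms weight)
open Literature.MathematicalPhysics.QuantumFieldTheory.Balaban1983to89.B12TreeDecay (kappa₀ K₀)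
open Summit.QuantumFields.BalabanUV.T4Continuum.B13Carriers (TwoRuns)
open Summit.QuantumFields.BalabanUV.T4Continuum.Spine.NE5
open Literature.MathematicalPhysics.QuantumFieldTheory.Balaban1983to89.TreeLengthTorusGeometry (TTouch)
open Literature.MathematicalPhysics.QuantumFieldTheory.Balaban1983to89.B13Resummation (locE)
open Summit.QuantumFields.YangMills.BalabanUVNodes.N18HLayerDatum (hH_of_terms226_record)
open YMDAG.UVSplit (U3Carriers N18At)
open YMDAG.N18.HLayer (n18At_of_terms226_record)

/-! ## §1 The two-margin data box inside a ball of the data space -/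

section Box

variable {C : Carriers} {Op Hist : Type*} [NormedAddCommGroup Op] [NormedSpace ℂ Op] [NormedAddCommGroup Hist]
  [NormedSpace ℂ Hist] (M : StepModel C Op Hist)

/-- **THE TWO-MARGIN BOX LIES IN THE BALL OF ANY RADIUS EXCEEDING BOTH MARGINS**: in the sup distance of `Op × Hist`,
`M.box k p = closedBall p.1 (rOp k) ×ˢ closedBall p.2 (rHist k) ⊆ ball p α` whenever `rOp k < α` and `rHist k < α` — the located
compatibility between route P1's margins (2.16)–(2.18) and the walk road's admissible configuration size `α`.
[cite: Balaban1988RG2Cluster, (2.16)–(2.18) p.16, p.15] -/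
theorem box_subset_ball (k : ℕ) (p : Op × Hist) {α : ℝ} (hOp : M.rOp k < α) (hHist : M.rHist k < α) :
    M.box k p ⊆ ball p α := by
  rintro ⟨z₁, z₂⟩ ⟨h₁, h₂⟩
  rw [mem_closedBall] at h₁ h₂
  rw [mem_ball, Prod.dist_eq]
  exact max_lt (h₁.trans_lt hOp) (h₂.trans_lt hHist)

/-- A function complex differentiable in the DISPLACEMENT `u` from `p` on `ball 0 α` is complex differentiable in place on `ball p α`
(translation `z ↦ z − p`; elementary). [cite: Balaban1988RG2Cluster, p.15] (elementary API) -/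
theorem differentiableOn_of_displaced {F : Type*} [NormedAddCommGroup F] [NormedSpace ℂ F] {T : Op × Hist → F}
    (p : Op × Hist) {α : ℝ} (h : DifferentiableOn ℂ (fun u => T (p + u)) (ball 0 α)) : DifferentiableOn ℂ T (ball p α) := by
  have hmaps : MapsTo (fun z : Op × Hist => z - p) (ball p α) (ball 0 α) := fun z hz => by
    simpa only [mem_ball, dist_eq_norm, sub_zero] using hz
  have hc := h.comp ((differentiable_id.sub_const p).differentiableOn) hmaps
  exact hc.congr fun z _ => by simp only [Function.comp_apply, id, add_sub_cancel]

omit [NormedSpace ℂ Op] [NormedSpace ℂ Hist] in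
/-- A bound holding in the displacement `u` from `p` on `ball 0 α` holds in place on `ball p α` (elementary).
[cite: Balaban1988RG2Cluster, p.15] (elementary API) -/
theorem bound_of_displaced {F : Type*} [NormedAddCommGroup F] {T : Op × Hist → F} (p : Op × Hist) {α : ℝ} {K : ℝ}
    (h : ∀ u ∈ ball (0 : Op × Hist) α, ‖T (p + u)‖ ≤ K) : ∀ z ∈ ball p α, ‖T z‖ ≤ K := by
  intro z hz
  have hu : z - p ∈ ball (0 : Op × Hist) α := by simpa only [mem_ball, dist_eq_norm, sub_zero] using hz
  simpa only [add_sub_cancel] using h (z - p) hu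

end Box

/-! ## §2 On the carriers of record: file 1's term data `hT` from ball data, in place or displaced -/

section Record

variable {G : Type} [GaugeGroup G] (R : TwoRuns G)
variable {Op Hist : Type*} [NormedAddCommGroup Op] [NormedSpace ℂ Op] [NormedAddCommGroup Hist] [NormedSpace ℂ Hist]
  (M : StepModel R.carriers Op Hist)
variable {L Mb : ℕ} [NeZero L] [NeZero Mb] (c : B13.Consts) {a a₅ : ℝ}

/-- **FILE 1's TERM DATA FROM BALL DATA (in place).**  If at every scale `j` the ball radius `α j` exceeds both margins and, around every
admissible base point `p`, every term is complex differentiable on `ball p (α j)` and obeys (2.26) there, then the ∃V-form `hT` of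
`N18HLayerDatum.hH_of_terms226_record` holds with `V := ball p (α j)`. [cite: Balaban1988RG2Cluster, p.15, (2.16)–(2.18) p.16, (2.26) p.17] -/
theorem termData_of_ballData_record
    (T : (j : ℕ) → (Z : TDom 4 (R.cubesPerDir j)) →
      Finset (TDom 4 (L * R.cubesPerDir j)) × Finset (TBond 4 Mb (L * R.cubesPerDir j)) → Op × Hist → ℂ)
    {W : Set (ℕ → ℝ)} {α : ℕ → ℝ} (hOp : ∀ j, M.rOp j < α j) (hHist : ∀ j, M.rHist j < α j)
    (hB : ∀ j, ∀ g ∈ W, ∀ (U : R.carriers.BgB) (p : Op × Hist), p ∈ M.Base j g U →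
      (∀ (Z : TDom 4 (R.cubesPerDir j)), ∀ t ∈ terms L Mb Z, DifferentiableOn ℂ (T j Z t) (ball p (α j))) ∧
      (∀ z ∈ ball p (α j), ∀ (Z : TDom 4 (R.cubesPerDir j)), ∀ t ∈ terms L Mb Z,
        ‖T j Z t z‖ ≤ weight L Mb c Z a t * Real.exp (a₅ * ((Z.1).card : ℝ)))) :
    ∀ j, ∀ g ∈ W, ∀ (U : R.carriers.BgB) (p : Op × Hist), p ∈ M.Base j g U →
      ∃ V : Set (Op × Hist), IsOpen V ∧ M.box j p ⊆ V ∧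
        (∀ (Z : TDom 4 (R.cubesPerDir j)), ∀ t ∈ terms L Mb Z, DifferentiableOn ℂ (T j Z t) V) ∧
        (∀ z ∈ V, ∀ (Z : TDom 4 (R.cubesPerDir j)), ∀ t ∈ terms L Mb Z,
          ‖T j Z t z‖ ≤ weight L Mb c Z a t * Real.exp (a₅ * ((Z.1).card : ℝ))) := by
  intro j g hg U p hp
  obtain ⟨hhol, h226⟩ := hB j g hg U p hp
  exact ⟨ball p (α j), isOpen_ball, box_subset_ball M j p (hOp j) (hHist j), hhol, h226⟩

/-- **FILE 1's TERM DATA FROM DISPLACED BALL DATA — the walk road's output shape at `B := Op × Hist`.**  If at every scale `j` the ball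
radius `α j` exceeds both margins and, around every admissible base point `p`, every term READ IN THE DISPLACEMENT `u = z − p` is complex
differentiable on `ball 0 (α j)` with (2.26) there (what T25 `TwoRunTorusWalkParam.hol_and_h226_torus_of_termWalkData_param` concludes for a
`TermKernels` record over `B := Op × Hist` whose kernels are the term's kernels at data `p + u`), then the ∃V-form `hT` of file 1 holds with
`V := ball p (α j)`. [cite: Balaban1988RG2Cluster, p.13, p.15, (2.16)–(2.18) p.16, (2.26) p.17; Balaban1985BackgroundPropagators, Thm 3.10 p.416] -/
theorem termData_of_displacedBallData_record
    (T : (j : ℕ) → (Z : TDom 4 (R.cubesPerDir j)) →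
      Finset (TDom 4 (L * R.cubesPerDir j)) × Finset (TBond 4 Mb (L * R.cubesPerDir j)) → Op × Hist → ℂ)
    {W : Set (ℕ → ℝ)} {α : ℕ → ℝ} (hOp : ∀ j, M.rOp j < α j) (hHist : ∀ j, M.rHist j < α j)
    (hU : ∀ j, ∀ g ∈ W, ∀ (U : R.carriers.BgB) (p : Op × Hist), p ∈ M.Base j g U →
      (∀ (Z : TDom 4 (R.cubesPerDir j)), ∀ t ∈ terms L Mb Z,
        DifferentiableOn ℂ (fun u : Op × Hist => T j Z t (p + u)) (ball 0 (α j))) ∧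
      (∀ u ∈ ball (0 : Op × Hist) (α j), ∀ (Z : TDom 4 (R.cubesPerDir j)), ∀ t ∈ terms L Mb Z,
        ‖T j Z t (p + u)‖ ≤ weight L Mb c Z a t * Real.exp (a₅ * ((Z.1).card : ℝ)))) :
    ∀ j, ∀ g ∈ W, ∀ (U : R.carriers.BgB) (p : Op × Hist), p ∈ M.Base j g U →
      ∃ V : Set (Op × Hist), IsOpen V ∧ M.box j p ⊆ V ∧
        (∀ (Z : TDom 4 (R.cubesPerDir j)), ∀ t ∈ terms L Mb Z, DifferentiableOn ℂ (T j Z t) V) ∧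
        (∀ z ∈ V, ∀ (Z : TDom 4 (R.cubesPerDir j)), ∀ t ∈ terms L Mb Z,
          ‖T j Z t z‖ ≤ weight L Mb c Z a t * Real.exp (a₅ * ((Z.1).card : ℝ))) := by
  refine termData_of_ballData_record R M c T hOp hHist fun j g hg U p hp => ?_
  obtain ⟨hhol, h226⟩ := hU j g hg U p hp
  exact ⟨fun Z t ht => differentiableOn_of_displaced p (hhol Z t ht),
    fun z hz Z t ht => bound_of_displaced p (fun u hu => h226 u hu Z t ht) z hz⟩

/-! ## §3 The H-layer datum `hH` and N18's decl of record from per-base-point displaced ball data -/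

variable (hL : 8 ≤ c.L) (hLc : c.L = L) {a₂ a₂' Aabs : ℝ}
variable (hα₆ : 0 < c.α₆) (hε₀ : 0 ≤ c.eps2) (hδ : 0 ≤ c.δ) (hδ7 : 0 ≤ 1 - 7 * c.δ) (hκ : 0 ≤ c.κ) (ha : 0 ≤ a)
  (hR15 : c.R15) (hR16 : 18 * ((1 - 4 * c.δ) * c.κ) ≤ a / 20) (hR16' : 4 * c.κ ≤ a / 20)
  (hR17 : Real.exp (-(a / 20)) ≤ c.eps2) (h231 : 2 * (4 : ℝ) * (Mb : ℝ) ^ 4 * Real.exp (-(a / 10)) ≤ a / 20)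
  (ha₂ : 0 ≤ a₂) (hκ229 : kappa₀ 64 8 + a₂ ≤ c.δ * c.κ)
  (hsm229 : c.α₆ * Real.exp a₂ * K₀ 64 8 * 64 ≤ a₂)
  (habsk : Real.exp (-(a / 20)) * 64 ≤ c.δ * c.κ)
  (h18half : B13Step237.R18half c (K₀ 64 8 * Real.exp (Real.exp (-(a / 20)) * 64)))
  (h18 : B13Step237.R18sharp c (K₀ 64 8 * Real.exp (Real.exp (-(a / 20)) * 64)) ((c.L : ℝ) / 2))
  (ha₂' : 0 ≤ a₂') (hκ229' : kappa₀ 64 8 + a₂' ≤ c.δ * ((c.L : ℝ) / 2) * c.κ)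
  (hsm229' : c.α₆ * Real.exp a₂' * K₀ 64 8 * 64 ≤ a₂')
  (hR20 : 18 * ((1 - 7 * c.δ) * ((c.L : ℝ) / 2) * c.κ) ≤ (c.κ₁ - 1) / 2)
  (ha₅ : 0 ≤ a₅) (habs : a₅ + Real.exp (-((c.κ₁ - 1) / 2)) ≤ Aabs)
  (hAc : Aabs * 64 ≤ c.δ * ((c.L : ℝ) / 2) * c.κ)
  (hC3 : B13Step237.bracketF c (K₀ 64 8 * Real.exp (Real.exp (-(a / 20)) * 64)) / c.α₆ *
    Real.exp (Aabs * 64) ≤ c.C3act * c.ε₁)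

include hL hLc hα₆ hε₀ hδ hδ7 hκ ha hR15 hR16 hR16' hR17 h231 ha₂ hκ229 hsm229 habsk h18half h18 ha₂' hκ229' hsm229'
  hR20 ha₅ habs hAc hC3

/-- **N18's W2 DATUM OF ROUTE P1 FROM PER-BASE-POINT DISPLACED BALL DATA** — `N18HLayerDatum.hH_of_terms226_record` ∘
`termData_of_displacedBallData_record`: the H-layer activity datum `hH` of `EnvelopeOnRecord.outputEnvelope_of_activities_record` VERBATIM
for the term-sum activities `act j z Z := Σ_{t ∈ terms L M Z} T j Z t z`, with `A = C₃ε₁`, `R_d = (1−8δ)½Lκ`, from: ball radii exceeding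
both margins, per admissible base point the term data in displacement coordinates on `ball 0 (α j)` (the walk road's output shape at
`B := Op × Hist`), and Lemma 3's printed restrictions on the constants.
[cite: Balaban1988RG2Cluster, (1.5) p.3, p.15, (2.16)–(2.18) p.16, (2.26) p.17, Lemma 3 (2.38) p.20] -/
theorem hH_of_displacedBallData_record
    (T : (j : ℕ) → (Z : TDom 4 (R.cubesPerDir j)) →
      Finset (TDom 4 (L * R.cubesPerDir j)) × Finset (TBond 4 Mb (L * R.cubesPerDir j)) → Op × Hist → ℂ)
    {W : Set (ℕ → ℝ)} {α : ℕ → ℝ} (hOp : ∀ j, M.rOp j < α j) (hHist : ∀ j, M.rHist j < α j)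
    (hU : ∀ j, ∀ g ∈ W, ∀ (U : R.carriers.BgB) (p : Op × Hist), p ∈ M.Base j g U →
      (∀ (Z : TDom 4 (R.cubesPerDir j)), ∀ t ∈ terms L Mb Z,
        DifferentiableOn ℂ (fun u : Op × Hist => T j Z t (p + u)) (ball 0 (α j))) ∧
      (∀ u ∈ ball (0 : Op × Hist) (α j), ∀ (Z : TDom 4 (R.cubesPerDir j)), ∀ t ∈ terms L Mb Z,
        ‖T j Z t (p + u)‖ ≤ weight L Mb c Z a t * Real.exp (a₅ * ((Z.1).card : ℝ)))) :
    ∀ j, ∀ g ∈ W, ∀ (U : R.carriers.BgB) (p : Op × Hist), p ∈ M.Base j g U →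
      ∃ V : Set (Op × Hist), IsOpen V ∧ M.box j p ⊆ V ∧
        (∀ Z : TDom 4 (R.cubesPerDir j),
          DifferentiableOn ℂ (fun z : Op × Hist => ∑ t ∈ terms L Mb Z, T j Z t z) V) ∧
        (∀ z ∈ V, ∀ Z : TDom 4 (R.cubesPerDir j), ‖∑ t ∈ terms L Mb Z, T j Z t z‖ ≤
          c.C3act * c.ε₁ * Real.exp (-((1 - 8 * c.δ) * ((c.L : ℝ) / 2) * c.κ * torusTreeLen Z.1))) :=
  hH_of_terms226_record c hL hLc hα₆ hε₀ hδ hδ7 hκ ha hR15 hR16 hR16' hR17 h231 ha₂ hκ229 hsm229 habsk h18half h18 ha₂'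
    hκ229' hsm229' hR20 ha₅ habs hAc hC3 R M T (termData_of_displacedBallData_record R M c T hOp hHist hU)

-- decidability instances as BINDERS (they unify with any consumer's; `Spine/NE5/EnvelopeOnRecord` TECHNICAL NOTE)
variable [∀ j, DecidableEq (TDom 4 (R.cubesPerDir j))] [∀ j, DecidableRel (TTouch (d := 4) (N := R.cubesPerDir j))]

/-- **N18 AT THE H-LAYER BUNDLE ON THE CARRIERS OF RECORD FROM PER-MEMBER, PER-BASE-POINT DISPLACED BALL DATA** — seat n18-d's term-layer
face `YMDAG.N18.HLayer.n18At_of_terms226_record` with its term data `hT b` MANUFACTURED by `termData_of_displacedBallData_record` for the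
member's step model `M b` and terms `T b`: per member `b ∈ ]0, γ]`, ball radii `α b j` exceeding both margins of `M b` and, around every
admissible base point, the term data in displacement coordinates on `ball 0 (α b j)` (the walk road T25's output shape at `B := Op × Hist`),
plus (2.13) over the term sums, Lemma 3's printed restrictions, the located numerals, the leaves and the sharp clause ⟹
`N18At ⟨R.carriers, W, γ, κ, EA, EB, θ′, C₅(C₃ε₁), Λ, C₉, ωm, cr, ρ⟩`.
[cite: Balaban1988RG2Cluster, (1.5) p.3, p.13, p.15, (2.13) p.14, (2.26) p.17, (2.38) p.20; Balaban1987RG1, Thm 1 p.259] -/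
theorem n18At_of_displacedBallData_record (Mf : ℝ → StepModel R.carriers Op Hist)
    (T : ℝ → (j : ℕ) → (Z : TDom 4 (R.cubesPerDir j)) →
      Finset (TDom 4 (L * R.cubesPerDir j)) × Finset (TBond 4 Mb (L * R.cubesPerDir j)) → Op × Hist → ℂ)
    {W : Set (ℕ → ℝ)} {γ κ : ℝ} {EA : Functional R.carriers R.carriers.BgA} {EB : ℝ → Functional R.carriers R.carriers.BgB}
    {EA₀ E₀ E₁ δ δ' θ θ' cH ω ρ₀ B : ℝ} {k₀ : ℕ}
    (hrep : ∀ b : ℝ, 0 < b → b ≤ γ → ∀ (X : R.carriers.Dom) (z : Op × Hist),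
      (Mf b).Out X.1 z.1 z.2 X =
        locE (TTouch (d := 4) (N := R.cubesPerDir X.1)) (fun Z : (tsys 4 (R.cubesPerDir X.1)).Dom => Z.1)
          (fun Z => ∑ t ∈ terms L Mb Z, T b X.1 Z t z) X.2.1)
    (hC3nn : 0 ≤ c.C3act) (hε₁ : 0 ≤ c.ε₁) (hκ0 : 0 ≤ κ)
    (hrate : κ + 2 * (64 * Real.log 162) + 2 ≤ (1 - 8 * c.δ) * ((c.L : ℝ) / 2) * c.κ)
    (hKP : c.C3act * c.ε₁ * Real.exp (5 * κ + 1) * K₀ 64 8 * 9 * 64 ≤ 1)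
    {α : ℝ → ℕ → ℝ} (hOp : ∀ b : ℝ, 0 < b → b ≤ γ → ∀ j, (Mf b).rOp j < α b j)
    (hHist : ∀ b : ℝ, 0 < b → b ≤ γ → ∀ j, (Mf b).rHist j < α b j)
    (hU : ∀ b : ℝ, 0 < b → b ≤ γ → ∀ j, ∀ g ∈ W, ∀ (U : R.carriers.BgB) (p : Op × Hist), p ∈ (Mf b).Base j g U →
      (∀ (Z : TDom 4 (R.cubesPerDir j)), ∀ t ∈ terms L Mb Z,
        DifferentiableOn ℂ (fun u : Op × Hist => T b j Z t (p + u)) (ball 0 (α b j))) ∧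
      (∀ u ∈ ball (0 : Op × Hist) (α b j), ∀ (Z : TDom 4 (R.cubesPerDir j)), ∀ t ∈ terms L Mb Z,
        ‖T b j Z t (p + u)‖ ≤ weight L Mb c Z a t * Real.exp (a₅ * ((Z.1).card : ℝ))))
    (l01 : ∀ b : ℝ, 0 < b → b ≤ γ → L01 (Mf b) EA W) (l02 : ∀ b : ℝ, 0 < b → b ≤ γ → L02 (Mf b) (EB b) W)
    (l03 : ∀ b : ℝ, 0 < b → b ≤ γ → L03 (Mf b) (EB b) W) (l05 : L05 EA W EA₀ κ)
    (l06 : ∀ b : ℝ, 0 < b → b ≤ γ → L06 (EB b) W E₀ κ) (l07 : ∀ b : ℝ, 0 < b → b ≤ γ → L07 (Mf b) W δ θ)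
    (l08 : ∀ b : ℝ, 0 < b → b ≤ γ → L08 (Mf b) W κ E₀ δ' θ) (l09aff : ∀ b : ℝ, 0 < b → b ≤ γ → L09aff (Mf b) W)
    (l09blind : ∀ b : ℝ, 0 < b → b ≤ γ → L09blind (Mf b) W) (l09hom : ∀ b : ℝ, 0 < b → b ≤ γ → L09hom (Mf b) W)
    (l09unit : ∀ b : ℝ, 0 < b → b ≤ γ → L09unit (Mf b) W κ E₁ cH ω)
    (hE₁ : 0 < E₁) (hδδ' : 0 ≤ δ + δ') (hθ : 0 ≤ θ) (hθθ' : θ ≤ θ') (hθ'1 : θ' ≤ 1) (hcH : 0 ≤ cH) (hω : 0 < ω)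
    (hρ₀ : ρ₀ < 1) (l10near : (δ + δ') * θ ^ k₀ + cH * (EA₀ + E₀) / (1 - ω) ≤ ρ₀) (hB : 0 ≤ B)
    (l10first : ∀ k < k₀, EA₀ + E₀ ≤ B * θ ^ k)
    (hS : Real.exp 1 * 9 * 64 * K₀ 64 8 ^ 2 * c.C3act * cH * c.ε₁ < (θ' - ω) * (1 - ρ₀))
    (Λ : ℕ → ℕ → ℝ) (C₉ ωm cr ρ : ℝ) :
    N18At ⟨R.carriers, W, γ, κ, EA, EB, θ',
      (Real.exp 1 * 9 * 64 * K₀ 64 8 ^ 2 * (c.C3act * c.ε₁) / (1 - ρ₀) * (δ + δ') + B) * (θ' - ω) /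
        (θ' - (ω + Real.exp 1 * 9 * 64 * K₀ 64 8 ^ 2 * (c.C3act * c.ε₁) / (1 - ρ₀) * cH)), Λ, C₉, ωm, cr, ρ⟩ :=
  n18At_of_terms226_record c hL hLc hα₆ hε₀ hδ hδ7 hκ ha hR15 hR16 hR16' hR17 h231 ha₂ hκ229 hsm229 habsk h18half h18 ha₂'
    hκ229' hsm229' hR20 ha₅ habs hAc hC3 R Mf T hrep hC3nn hε₁ hκ0 hrate hKP
    (fun b hb hbγ => termData_of_displacedBallData_record R (Mf b) c (T b) (hOp b hb hbγ) (hHist b hb hbγ) (hU b hb hbγ))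
    l01 l02 l03 l05 l06 l07 l08 l09aff l09blind l09hom l09unit hE₁ hδδ' hθ hθθ' hθ'1 hcH hω hρ₀ l10near hB l10first hS Λ C₉
    ωm cr ρ

end Record

end Summit.QuantumFields.YangMills.BalabanUVNodes.N18HLayerDatumBall

end
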